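import Summits.BirchSwinnertonDyer.BirchSwinnertonDyer.Theorems.SchneiderFreeAdditiveX3SemistableTwistLocalThreeMult
import Summits.BirchSwinnertonDyer.BirchSwinnertonDyer.Theorems.SchneiderFreeAdditiveX3KYNonAnomalousTwistOfPrint
import HarnessLib

/-!
# Route `SchneiderFreeAdditiveX3` (K1 door), (M) cell: generations 23–24's PUBLISHED-FACT road ([INV.μ] + `Λ`-torsion from CGLS Prop. 14,
# the door inequality) AT EVERY ODD `p` — in particular `p = 3` — FOR THE POTENTIALLY MULTIPLICATIVE PAIRS WITH A NON-SPLIT TWIST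

Cell `bsd-schneider-ideate`, seat `bsd-schneider-door-c5` (prover, generation 25; assembly layer; `--supports` 19177; FYI crux r2 19176).
PARTITION: board row B6 ∩ X3 ∩ sst-twist, `r = 1` (7 101 pairs; (M) half 4 541, of which 4 383 at `p = 3`) of `Rank1Residual.partition`;
types-the-object-of nothing new; EXTENDS the `p ≥ 5` cell forms of generations 23–24 on the (M) cell (158 census pairs) to the 1 127 (M) pairs
at `p = 3` whose multiplicative twist `E^{(−3)}` is NON-SPLIT (kit j319291); closes none of B6's cells (BSD NOT advanced).
bears_on: K1-door (items 18971/18972 → 19177 r3; 19176 r2).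

WHAT.  The twin of `…KYNonAnomalousTwistOfPrint` on the (M) cell `ClassX3 W p ∧ SubM W p`, `2 < p`, under the census-checkable per-pair clause

  `NST(W, p)`: every globally minimal multiplicative `p*`-twist model `V` of `W` (`W = C • V^{(p*)}`) is NON-SPLIT at `p`

(spelled out as a `∀ V C, …` binder), with `hna` from `…SemistableTwistLocalThreeMult` (Tate line + Frobenius of the twist):
* §1 `hna` in both shapes; §2 [INV.μ] + `Λ`-torsion of `X_ac^∅(E_K)` ⟸ CGLS22 Prop. 14 [PUBLISHED] — at `p = 3` this REPLACES the preprint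
  character sentence `prop125…_OPEN` for the 1 127 pairs; §3 THE DOOR INEQUALITY `λ(𝔛_{θsub}) + λ(𝔛_{θquot}) + ΣΣ λ𝒫_w(θ) ≤ λ(X_ac^∅(E_K)) +
  Σ_{w∈Sf} λ𝒫_w(E_K)` mod 10 PUB (the generic `_of_nonAnomalous` form of the companion file, fed §1).

HONEST FRAMING: one-line compositions of tree theorems, CONDITIONAL BY NAME on published facts typed as `Prop`s (none introduced here); no
definition, no named fact, no `sorry`; nothing analytic, nothing for the pairs with SPLIT twist (3 256 of 4 383 at `p = 3`), nothing about BSD or a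
main conjecture is asserted; «closes rung: none».  References: CGLS, Invent. Math. 227 (2022) §1.2, §1.4 [CastellaGrossiLeeSkinner2022]; Keller–Yin
arXiv:2402.12781 Thm. 1.4.1 [KellerYin2024]; arXiv:2410.23241 §3.5 [KellerYin2024b]; Silverman *ATAEC* V.5 [SilvermanATAEC1994].
-/


set_option autoImplicit false
set_option linter.dupNamespace false -- the summit namespace `…BirchSwinnertonDyer.BirchSwinnertonDyer.Theorems` (Sub = Summit, D-0017) trips it

noncomputable section

open scoped Classical Pointwise NumberField

open WeierstrassCurve NumberField IsDedekindDomain Field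
  Literature.NumberTheory.EllipticCurves Literature.NumberTheory.EllipticCurves.IwasawaAlgebra
  Literature.NumberTheory.EllipticCurves.GreenbergSelmer
  Literature.NumberTheory.EllipticCurves.GreenbergVatsal2000
  Literature.NumberTheory.GaloisRepresentations IsDedekindDomain.HeightOneSpectrum
  Literature.NumberTheory.EllipticCurves.Rank1Residual Literature.NumberTheory.EllipticCurves.KellerYin2024
  Literature.NumberTheory.EllipticCurves.IwasawaDual Literature.NumberTheory.EllipticCurves.Castella2018.AcSelmer
  Literature.NumberTheory.IwasawaTheory Literature.NumberTheory.IwasawaTheory.Greenberg2016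
  Literature.NumberTheory.IwasawaTheory.Greenberg2006
  Summit.BirchSwinnertonDyer.Rank1Residual Summit.BirchSwinnertonDyer.Rank1Residual.Additive
  Summit.BirchSwinnertonDyer.Rank1Residual.X2.ResidualDevissageModules
  Summit.BirchSwinnertonDyer.BirchSwinnertonDyer.Theorems
  Summit.BirchSwinnertonDyer.BirchSwinnertonDyer.Theorems.SchneiderFreeAdditiveX3
  Summit.BirchSwinnertonDyer.BirchSwinnertonDyer.Theorems.SchneiderFreeAdditiveX3.KYLambdaAlg
  Summit.BirchSwinnertonDyer.BirchSwinnertonDyer.Theorems.SchneiderFreeAdditiveX3.KYLambdaAlgChar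
  Summit.BirchSwinnertonDyer.BirchSwinnertonDyer.Theorems.SchneiderFreeAdditiveX3.KYMuZeroOfPrint
  Summit.BirchSwinnertonDyer.BirchSwinnertonDyer.Theorems.SchneiderFreeAdditiveX3.SemistableTwistLocalThree
  Summit.BirchSwinnertonDyer.BirchSwinnertonDyer.Theorems.SchneiderFreeAdditiveX3.KYNonAnomalousTwist
open Literature.NumberTheory.EllipticCurves.CastellaGrossiLeeSkinner2022
  (cor126_residualCharacter_globalLift cor126_residualCharacter_localSurjective
    prop125_characterGrSelmerDual_torsion_muZero_dim prop14_residualCharacterSelmer_finite)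

namespace Summit.BirchSwinnertonDyer.BirchSwinnertonDyer.Theorems.SchneiderFreeAdditiveX3.KYNonSplitTwist

variable {p : ℕ} [hp : Fact p.Prime]

/-! ### §1 The non-anomalous clause on the (M) cell under `NST(W, p)`, both shapes -/

/-- **`hna`, rational-line shape, (M) cell, every odd `p`:** on `ClassX3 W p ∧ SubM W p` with `NST(W, p)`, for every place `v ∋ p`, every
rational line `Φ ≤ W[p]` and every `𝔓 ∣ v`, `D_𝔓` neither fixes `Φ` pointwise nor acts trivially on `W[p]/Φ`.
[cite: SilvermanATAEC1994, Ch. V Thm. 5.3, Cor. 5.4] [cite: SilvermanAEC2009, X.5 Cor. 5.4] -/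
theorem hna_isRationalLine_of_subM_of_forall_twist (W : WeierstrassCurve ℚ) [W.IsElliptic] [W.IsGloballyMinimal]
    (hp2 : 2 < p) (hX : ClassX3 W p) (hSM : SubM W p)
    (hns : ∀ (V : WeierstrassCurve ℚ) [V.IsElliptic] [V.IsGloballyMinimal] (C : VariableChange ℚ),
      Mult V p → C • V.quadraticTwist ((-1 : ℚ) ^ (p / 2) * p) = W → ¬ V.HasSplitMultiplicativeReductionAtPrime p) :
    ∀ (v : HeightOneSpectrum (𝓞 ℚ)), ((p : ℕ) : 𝓞 ℚ) ∈ v.asIdeal →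
      ∀ (Φ : AddSubgroup (geomTorsion W (p : ℤ))), IsRationalLine W p Φ →
      ∀ 𝔓 ∈ v.primesAbove,
        (¬ ∀ g ∈ 𝔓.decompositionSubgroup (absoluteGaloisGroup ℚ), ∀ P ∈ Φ, g • P = P) ∧
          (¬ ∀ g ∈ 𝔓.decompositionSubgroup (absoluteGaloisGroup ℚ),
            ∀ P : geomTorsion W (p : ℤ), g • P - P ∈ Φ) :=
  fun _ hpv _ hΦ _ h𝔓 ↦
    not_fix_and_not_quot_of_classX3_of_subM_of_forall_twist W p hp2.ne' hX hSM hns hpv h𝔓 hΦ.1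

/-- **`hna`, every subgroup of order `p`, (M) cell, every odd `p`** (the shape consumed by B1/B2/C).
[cite: SilvermanATAEC1994, Ch. V Thm. 5.3, Cor. 5.4] [cite: CastellaGrossiLeeSkinner2022, §1.2 (hypothesis θ|_{G_v̄} ≠ 𝟙, ω)] -/
theorem hna_card_of_subM_of_forall_twist (W : WeierstrassCurve ℚ) [W.IsElliptic] [W.IsGloballyMinimal]
    (hp2 : 2 < p) (hX : ClassX3 W p) (hSM : SubM W p)
    (hns : ∀ (V : WeierstrassCurve ℚ) [V.IsElliptic] [V.IsGloballyMinimal] (C : VariableChange ℚ),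
      Mult V p → C • V.quadraticTwist ((-1 : ℚ) ^ (p / 2) * p) = W → ¬ V.HasSplitMultiplicativeReductionAtPrime p) :
    ∀ (v : HeightOneSpectrum (𝓞 ℚ)), ((p : ℕ) : 𝓞 ℚ) ∈ v.asIdeal →
      ∀ (Φ : AddSubgroup (geomTorsion W (p : ℤ))), Nat.card Φ = p →
      ∀ 𝔓 ∈ v.primesAbove,
        (¬ ∀ g ∈ 𝔓.decompositionSubgroup (absoluteGaloisGroup ℚ), ∀ P ∈ Φ, g • P = P) ∧
          (¬ ∀ g ∈ 𝔓.decompositionSubgroup (absoluteGaloisGroup ℚ),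
            ∀ P : geomTorsion W (p : ℤ), g • P - P ∈ Φ) :=
  fun _ hpv _ hΦ _ h𝔓 ↦
    not_fix_and_not_quot_of_classX3_of_subM_of_forall_twist W p hp2.ne' hX hSM hns hpv h𝔓 hΦ

/-! ### §2 [INV.μ] and the `Λ`-torsion clause from CGLS22 Prop. 14 [PUB] on the (M) cell, every odd `p` (new: `p = 3`) -/

/-- **On the (M) cell with `NST(W, p)`, `2 < p`: `X_ac^∅(E_K[p^∞])` is `Λ`-torsion with `μ = 0` ⟸ CGLS22 Prop. 14 (PUBLISHED)** — for every
Heegner `K` for `N_W` with `(p)` split, `v̄ ∋ p`, THE anticyclotomic `κ`, a generator `γ`.  F3 §1 (`isTorsion_muInvariant_eq_zero_empty_of_prop14_of_nonAnomalous`)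
with §1's `hna`.  At `p = 3` the clauses "`𝔛` is `Λ`-torsion" / "`μ(𝔛) = 0`" of Keller–Yin arXiv:2402.12781 Lemma 5.1.1 / Thm. 5.2.1 on the (M) cell
thereby rest on a refereed theorem for the 1 127 non-split-twist pairs (census kit j319291).  CONDITIONAL on `hfact`; nothing asserted about BSD.
[cite: CastellaGrossiLeeSkinner2022, §1.2 Prop. 14, §1.4 Props. 17–18 (arXiv:2008.02571; Invent. Math. 227 (2022))]
[cite: KellerYin2024, Lemma 5.1.1 (arXiv:2402.12781v2 §5.1) (preprint; derived here for odd p under NST)] -/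
theorem isTorsion_muInvariant_eq_zero_empty_of_prop14_of_subM_of_forall_twist
    (hfact : prop14_residualCharacterSelmer_finite)
    (W : WeierstrassCurve ℚ) [W.IsElliptic] [W.IsGloballyMinimal]
    (K : Type) [Field K] [NumberField K] (vbar : HeightOneSpectrum (𝓞 K))
    (κ : ZpExtension K p) (γ : absoluteGaloisGroup K) [Fact (κ.IsTopGenerator γ)]
    (hp2 : 2 < p) (hX : ClassX3 W p) (hSM : SubM W p)
    (hns : ∀ (V : WeierstrassCurve ℚ) [V.IsElliptic] [V.IsGloballyMinimal] (C : VariableChange ℚ),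
      Mult V p → C • V.quadraticTwist ((-1 : ℚ) ^ (p / 2) * p) = W → ¬ V.HasSplitMultiplicativeReductionAtPrime p)
    (hK : IsImaginaryQuadratic K) (hH : SatisfiesHeegnerHypothesis (W.conductorNorm ℤ) K)
    (hsplit : ((Ideal.span {(p : ℤ)}).primesOver (𝓞 K)).ncard = 2)
    (hvbar : ((p : ℕ) : 𝓞 K) ∈ vbar.asIdeal) (hκ : κ.IsAnticyclotomic) :
    Module.IsTorsion (IwasawaAlgebra p) (XAc (W.baseChange K) p κ vbar ∅ γ) ∧
      muInvariant p (XAc (W.baseChange K) p κ vbar ∅ γ) = 0 :=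
  isTorsion_muInvariant_eq_zero_empty_of_prop14_of_nonAnomalous hfact W K vbar κ γ hp2 hX.1 hK hH hsplit hvbar hκ
    (hna_isRationalLine_of_subM_of_forall_twist W hp2 hX hSM hns)

/-! ### §3 The DOOR INEQUALITY on the (M) cell under `NST(W, p)` -/

/-- **THE DOOR INEQUALITY ON THE (M) CELL WITH `NST(W, p)`, every odd `p` — in particular at `p = 3` for the 1 127 non-split-twist pairs:**
`λ(𝔛_{θsub}) + λ(𝔛_{θquot}) + Σ_{w∈Sf}(λ𝒫_w(θsub) + λ𝒫_w(θquot)) ≤ λ(X_ac^∅(E_K)) + Σ_{w∈Sf} λ𝒫_w(E_K)` for every residual pair of `E_K[p]` and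
ALL primitive strict dual data, modulo the ten published facts (`KYNonAnomalousTwist.add_add_sum_le_…_of_nonAnomalous_of_facts` fed §1).
[cite: KellerYin2024, Prop. 1.2.5, Thm. 1.4.1, §1.5 and Lemma 5.1.1 (arXiv:2402.12781v2)]
[cite: GreenbergVatsal2000, §2 Cor. (2.3), Prop. (2.4)] [cite: CastellaGrossiLeeSkinner2022, §1.2 Prop. 1.2.5, Cor. 1.2.6, Prop. 14, §1.4]
[cite: Greenberg2016Selmer, Props. 2.6.3, 4.1.1] [cite: Greenberg2006, Props. 3.2, 4.1, 4.2, §5 A] -/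
theorem add_add_sum_le_lambdaInvariant_xAc_empty_add_sum_curveLocalLambda_of_subM_of_forall_twist_of_facts
    (hprop125 : prop125_characterGrSelmerDual_torsion_muZero_dim) (hfact : prop14_residualCharacterSelmer_finite)
    (hlift : cor126_residualCharacter_globalLift) (hlocal : cor126_residualCharacter_localSurjective)
    (h411 : prop411_selmer_isAlmostDivisible) (h263 : prop263_sur_of_crk) (h41 : prop41_globalEulerPoincareCorank)
    (h42 : prop42_localEulerPoincareCorank) (h5A : sec5A_localH2_subsingleton_of_LOC1)
    (h32 : prop32_cohomology_isCofinitelyGenerated)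
    (W : WeierstrassCurve ℚ) [W.IsElliptic] [W.IsGloballyMinimal]
    (K : Type) [Field K] [NumberField K] {v : HeightOneSpectrum (𝓞 K)} (vbar : HeightOneSpectrum (𝓞 K))
    (κ : ZpExtension K p) (γ : absoluteGaloisGroup K) [hγ : Fact (κ.IsTopGenerator γ)]
    (Sf : Finset (HeightOneSpectrum (𝓞 K)))
    (hp2 : 2 < p) (hX : ClassX3 W p) (hSM : SubM W p)
    (hns : ∀ (V : WeierstrassCurve ℚ) [V.IsElliptic] [V.IsGloballyMinimal] (C : VariableChange ℚ),
      Mult V p → C • V.quadraticTwist ((-1 : ℚ) ^ (p / 2) * p) = W → ¬ V.HasSplitMultiplicativeReductionAtPrime p)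
    (hK : IsImaginaryQuadratic K) (hH : SatisfiesHeegnerHypothesis (W.conductorNorm ℤ) K)
    (hsplit : ((Ideal.span {(p : ℤ)}).primesOver (𝓞 K)).ncard = 2)
    (hv : ((p : ℕ) : 𝓞 K) ∈ v.asIdeal) (hvbar : ((p : ℕ) : 𝓞 K) ∈ vbar.asIdeal) (hne : vbar ≠ v) (hκ : κ.IsAnticyclotomic)
    (hSf : ∀ w : HeightOneSpectrum (𝓞 K), w ∈ Sf ↔
      (((W.conductorNorm ℤ : ℤ) : 𝓞 K) ∈ w.asIdeal ∧ ((p : ℕ) : 𝓞 K) ∉ w.asIdeal))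
    (θsub θquot : FramedGaloisRep K (padicCoeffIntegers (∅ : Set (PadicAlgCl p))) 1)
    (hpair : IsResidualPairOver (W.baseChange K) p θsub θquot)
    (D0sub : GrDualData κ (charModule (∅ : Set (PadicAlgCl p)) θsub) vbar (∅ : Set (HeightOneSpectrum (𝓞 K))) γ)
    (D0quot : GrDualData κ (charModule (∅ : Set (PadicAlgCl p)) θquot) vbar (∅ : Set (HeightOneSpectrum (𝓞 K))) γ) :
    lambdaInvariant p D0sub.X + lambdaInvariant p D0quot.X +
        ∑ w ∈ Sf, (charLocalLambda (∅ : Set (PadicAlgCl p)) κ θsub w + charLocalLambda (∅ : Set (PadicAlgCl p)) κ θquot w) ≤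
      lambdaInvariant p (XAc (W.baseChange K) p κ vbar (∅ : Set (HeightOneSpectrum (𝓞 K))) γ) +
        ∑ w ∈ Sf, curveLocalLambda κ (W.baseChange K) w :=
  add_add_sum_le_lambdaInvariant_xAc_empty_add_sum_curveLocalLambda_of_nonAnomalous_of_facts hprop125 hfact hlift hlocal h411
    h263 h41 h42 h5A h32 W K vbar κ γ Sf hp2 hX.1 hK hH hsplit hv hvbar hne hκ hSf
    (hna_card_of_subM_of_forall_twist W hp2 hX hSM hns) θsub θquot hpair D0sub D0quot

end Summit.BirchSwinnertonDyer.BirchSwinnertonDyer.Theorems.SchneiderFreeAdditiveX3.KYNonSplitTwist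

end
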